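import Mathlib

/-!
# `Balaban1983to89.Beta.BubbleTable` — the second variation of a lattice `log det` with LOCAL (stencil) vertices and a
translation-invariant colour-diagonal propagator IS a finite LEG TABLE `Σ_i c_i · P_i(w) · Q_i(w)` plus a contact term

HONEST FRAMING (page 1 of everything in the pub-balaban BETA cell).  Discharging `FlowStep.BetaPertH` — the located,
UNPRINTED input of Bałaban's ultraviolet-stability theorem — would make Bałaban's UV stability UNCONDITIONAL, a real
constructive-QFT result; it is NOT the continuum limit and NOT the Clay problem.  THIS FILE PROVES NOTHING ABOUT
BAŁABAN'S OPERATORS.  It is elementary finite-dimensional linear algebra ([folklore]): the bookkeeping identity by which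
the background-field (log-det) route of row BETA-an2 (HOME/BETA/AN2.md §10, item (iii) of BETA-SPEC §6.9 = (L2)) hands
its output to the JOIN of row an3 (`Beta.BubbleTransfer`, whose `lattBubble s c P Q L k w = Σ_{i∈s} c_i·P_i(L,k;w)·Q_i(L,k;w)`
is the shape produced here).

WHAT IS IN PRINT (context, cited by number, never used as authority).  [Balaban1987RG1] T. Bałaban, Renormalization
group approach to lattice gauge field theories. I, Comm. Math. Phys. 109 (1987) 249–301: p. 263–264 (1.20) the vacuum
polarization tensor `Π^{(k)}_{μν}` = the second-order (in the background field) term of the k-th effective action,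
(1.22) `β⁰_{k+1} = Σ_x Π⁰^{(k+1)}_{μν}(x) x_μ x_ν` (μ ≠ ν).  [Balaban1985BackgroundPropagators] T. Bałaban, Propagators for
lattice gauge theories in a background field, Comm. Math. Phys. 99 (1985) 389–434: p. 392 (3.10)–(3.13) the operator
`Δ(U) = D*_U D_U + Δ′` and its role in the expansion of the Wilson action to second order.  In the log-det route
(AN2.md §1, §3, §10.0) each one-loop term of the effective action is `−½ log det K(B)` (or a local Jacobian term) for a
`B`-dependent finite matrix `K(B)` over (sites × internal indices), and by the Jacobi/resolvent master formula — IN THE TREE: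
`Beta.LogDetHessian.fderiv_fderiv_log_det` (pv09-g3, p178018): `D²(log det K)(x₀)[u,v] = tr(K₀⁻¹ D²K[u,v]) − tr(K₀⁻¹ DK[u] K₀⁻¹ DK[v])`
— its second variation in `B` at `B = 0` is a CONTACT term `tr(G·∂_z∂_{z′}K)` minus a BUBBLE `tr(G·∂_zK·G·∂_{z′}K)`,
`G = K(0)⁻¹`.

WHAT THIS FILE PROVES ([folklore]; every statement is an identity between finite sums of real numbers).
* §1 `block K u v` (the colour block of a matrix over `Λ × C` at the pair of sites `(u, v)`), the ELEMENTARY INSERTION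
  `elemIns x y m` = (site matrix unit at `(x, y)`) ⊗ (colour matrix `m`), and the row-collapse lemma `mul_elemIns_apply`.
* §2 THE BUBBLE TRACE IDENTITY for ARBITRARY `K, K′` (no translation invariance):
  `trace (K·E_{x,y,m}·(K′·E_{x′,y′,m′})) = trace (block K y′ x · m · (block K′ y x′ · m′))` (`trace_mul_elemIns_mul`), and
  the contact identity `trace (K·E_{x,y,m}) = trace (block K y x · m)` (`trace_mul_elemIns`).
* §3 TRANSLATION-INVARIANT PROPAGATORS on a finite additive group `Λ` (the unit torus; invariance under its translations
  only): the MATRIX-VALUED kernel `mconvKernel g ((u,a),(v,b)) = g(v − u) a b` (`C` = everything inside a block: fine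
  positions, directions, colours — the honest generality for the U = 1 propagators of the effective actions, whose direction
  and block structure is not diagonal) with `block (mconvKernel g) u v = g(v − u)`, hence
  `trace (G·E_{x,y,m}·(G′·E_{x′,y′,m′})) = trace (g(x − y′)·m·(g′(x′ − y)·m′))` (`bubble_elem_m`) — ONE PRODUCT OF TWO LEGS,
  which `trace_mul₄_eq_sum` spells out as a finite sum of products of two SCALAR leg entries with vertex coefficients — and
  `trace (G·E_{x,y,m}) = trace (g(x − y)·m)` (`contact_elem_m`); the COLOUR-DIAGONAL special case
  `convKernel g ((u,a),(v,b)) = δ_{ab}·g(v − u)` (`convKernel_eq_mconvKernel`): `= g(x − y′)·g′(x′ − y)·trace(m·m′)`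
  (`bubble_elem`), `= g(x − y)·trace m` (`contact_elem`).
* §4 STENCIL VERTICES `stencilIns z S α β m = Σ_{s∈S} E_{z+α s, z+β s, m s}` (a first-order vertex of a LOCAL operator at
  background site `z`: finitely many matrix units at bounded offsets — the shape delivered pointwise by
  `Beta.BackgroundVertices` (V₁ = a commutator insertion along one bond) and `Beta.TransportVertices` (transport
  vertices along a contour)): by bilinearity (`trace_bubble_stencil`) and §3, THE TABLE THEOREMS `bubble_stencil_eq_table_m` (matrix-valued legs:
  `Σ_{(s,t)∈S×S′} trace (g(α s − β′ t − w)·m s·(g′(w + α′ t − β s)·m′ t))`), `contact_stencil_m`, and in the colour-diagonal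
  case `bubble_stencil_eq_table`:
  `trace (G·V_z·(G·V′_{z+w})) = Σ_{(s,t)∈S×S′} trace(m s · m′ t) · ( g(α s − β′ t − w) · g(w + α′ t − β s) )`
  — literally a finite table `Σ_i c_i·P_i(w)·Q_i(w)` whose legs are TRANSLATES (and one reflection) of the propagator
  kernel `g`, with coefficients `c_i = trace(m s · m′ t)` (colour traces) that do not depend on `w`, on the volume, or on
  `g`; and the contact term `contact_stencil` `trace (G·V₂) = Σ_s g(α s − β s)·trace(m s)` (values of `g` at BOUNDED
  offsets only).
* §6 THE (M)-OUTPUT SHAPE `polarization G V V₂ z z′ = trace(G·V₂ z z′) − trace(G·V z·(G·V z′))` (a definition — its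
  identification with `∂_z∂_{z′} log det K(0)` is the tree theorem `LogDetHessian.fderiv_fderiv_log_det`, not re-proved) and
  `polarization_eq_table`: for translated stencil vertices and `G = convKernel g` the polarization at `(z, z + w)` is a
  contact table (values of `g` at bounded offsets) minus the leg table of §4, independent of `z` (`polarization_translate`),
  and equal to minus the leg table alone outside the finite support of the second-order vertex
  (`polarization_eq_neg_bubble_of_not_mem`).
* §5 THE DIFFERENCE MECHANISM (`sum_mul_eq_sum_mul_sub`, `table_relabel_differences`): if a coefficient sum vanishes,
  `Σ_s c_s = 0`, then `Σ_s c_s·F(s) = Σ_s c_s·(F(s) − F₀)` — the one-line algebra by which vanishing vertex sums (exact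
  lattice Ward identities, item (iv)) turn translated legs `g(w + α)` into DIFFERENCE legs `g(w + α) − g(w)` (one power
  of decay better each), i.e. turn the raw degree-4 table of §4 into the degree-6 table `Beta.BubbleTransfer` consumes.
  WHICH sums vanish for Bałaban's operators is NOT proved here.

HOW IT IS MEANT TO BE USED (remark; nothing below the header depends on it).  With `K(B) = K₀ + Σ_z B(z)·V_z + ½Σ B(z)B(z′)·V₂(z,z′)`
the (M)-formula gives `∂_z∂_{z′}(−½ log det K)(0) = ½·trace(G V_z G V_{z′}) − ½·trace(G V₂(z,z′))`; §4 writes the first as a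
leg table in `w = z′ − z` when `G` is translation invariant and colour diagonal (the U = 1 propagators of the small-field
effective actions on the torus, in a covariant gauge), and the second as a finitely supported function of `w` with
coefficients `g` at bounded offsets.  What (L2)/(iii) still owes after this file (AN2.md §10.3 (β)(γ), §10.6 (N3)):
(1) that Bałaban's `Δ(U)`, `Q_k(U)`, gauge-fixing and unit-lattice operators at `U = exp(iηB)` have stencil first/second
vertices with `k`-UNIFORM stencils and coefficients in the (1.18)-type norms (pointwise η-bookkeeping: `BackgroundVertices`,
`TransportVertices`); (2) the `Leg` property (continuum part + one-power-better error with `(L,k)`-free constants) of the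
translated/differenced propagator legs — items (i) [an5] and (ii) [an1]; (3) the vanishing sums of §5 = the exact lattice
Ward identities [item (iv)].  NOT summit progress; NOT continuum, NOT Clay.

References (BibTeX keys of `references.bib`): [Balaban1987RG1], [Balaban1985BackgroundPropagators] (context only).
Unit `b2b-balaban-beta-an2-g3` (BETA cell, row an2, gen 3); journal claim BETA-an2-N3-BUBBLETABLE; staged byte-identically
under `HOME/lean/BalabanYm4/`.
-/

namespace Literature.MathematicalPhysics.QuantumFieldTheory.Balaban1983to89.Beta.BubbleTable

open Matrix Finset
open scoped BigOperators

variable {Λ : Type*} [Fintype Λ] [DecidableEq Λ] {C : Type*} [Fintype C] [DecidableEq C]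

/-! ## §1 Colour blocks and elementary insertions -/

/-- The colour block of a matrix over `Λ × C` at the pair of sites `(u, v)`: `(block K u v) a b = K (u,a) (v,b)`.
[folklore] -/
def block (K : Matrix (Λ × C) (Λ × C) ℝ) (u v : Λ) : Matrix C C ℝ := Matrix.of fun a b => K (u, a) (v, b)

omit [Fintype Λ] [DecidableEq Λ] [Fintype C] [DecidableEq C] in
/-- Entries of `block`. [folklore] -/
@[simp] theorem block_apply (K : Matrix (Λ × C) (Λ × C) ℝ) (u v : Λ) (a b : C) : block K u v a b = K (u, a) (v, b) := rfl

/-- The ELEMENTARY INSERTION at the pair of sites `(x, y)` with colour matrix `m`: the site matrix unit `e_{xy}` tensor `m`,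
`elemIns x y m (u,a) (v,b) = [u = x ∧ v = y]·m a b`. [folklore] -/
def elemIns (x y : Λ) (m : Matrix C C ℝ) : Matrix (Λ × C) (Λ × C) ℝ :=
  Matrix.of fun i j => if i.1 = x ∧ j.1 = y then m i.2 j.2 else 0

omit [Fintype Λ] [Fintype C] [DecidableEq C] in
/-- Entries of `elemIns`. [folklore] -/
@[simp] theorem elemIns_apply (x y : Λ) (m : Matrix C C ℝ) (u v : Λ) (a b : C) :
    elemIns x y m (u, a) (v, b) = if u = x ∧ v = y then m a b else 0 := rfl

omit [DecidableEq C] in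
/-- ROW COLLAPSE: `(K · E_{x,y,m}) (u,a) (v,b) = [v = y] · (block K u x · m) a b`. [folklore] -/
theorem mul_elemIns_apply (K : Matrix (Λ × C) (Λ × C) ℝ) (x y : Λ) (m : Matrix C C ℝ) (u v : Λ) (a b : C) :
    (K * elemIns x y m) (u, a) (v, b) = if v = y then (block K u x * m) a b else 0 := by
  rw [Matrix.mul_apply, Fintype.sum_prod_type]
  by_cases hv : v = y
  · rw [if_pos hv, Matrix.mul_apply, Fintype.sum_eq_single x]
    · simp [hv]
    · intro u' hu'
      simp [hu']
  · rw [if_neg hv]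
    simp [hv]

/-! ## §2 The bubble and contact trace identities for arbitrary `K, K′` -/

omit [DecidableEq C] in
/-- **BUBBLE TRACE IDENTITY** (no translation invariance):
`trace (K · E_{x,y,m} · (K′ · E_{x′,y′,m′})) = trace (block K y′ x · m · (block K′ y x′ · m′))` — the trace over sites and
colours collapses to a trace over colours of the two propagator blocks joining the insertion points. [folklore] -/
theorem trace_mul_elemIns_mul (K K' : Matrix (Λ × C) (Λ × C) ℝ) (x y x' y' : Λ) (m m' : Matrix C C ℝ) :
    Matrix.trace (K * elemIns x y m * (K' * elemIns x' y' m')) =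
      Matrix.trace (block K y' x * m * (block K' y x' * m')) := by
  simp only [Matrix.trace, Matrix.diag]
  rw [Fintype.sum_prod_type, Fintype.sum_eq_single y']
  · apply Finset.sum_congr rfl
    intro a _
    rw [Matrix.mul_apply, Matrix.mul_apply, Fintype.sum_prod_type, Fintype.sum_eq_single y]
    · apply Finset.sum_congr rfl
      intro b _
      rw [mul_elemIns_apply, mul_elemIns_apply, if_pos rfl, if_pos rfl]
    · intro v hv
      apply Finset.sum_eq_zero
      intro b _
      rw [mul_elemIns_apply, if_neg hv, zero_mul]
  · intro u hu
    apply Finset.sum_eq_zero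
    intro a _
    rw [Matrix.mul_apply]
    apply Finset.sum_eq_zero
    intro j _
    obtain ⟨v, b⟩ := j
    rw [mul_elemIns_apply K' x' y' m' v u b a, if_neg hu, mul_zero]

omit [DecidableEq C] in
/-- **CONTACT TRACE IDENTITY**: `trace (K · E_{x,y,m}) = trace (block K y x · m)`. [folklore] -/
theorem trace_mul_elemIns (K : Matrix (Λ × C) (Λ × C) ℝ) (x y : Λ) (m : Matrix C C ℝ) :
    Matrix.trace (K * elemIns x y m) = Matrix.trace (block K y x * m) := by
  simp only [Matrix.trace, Matrix.diag]
  rw [Fintype.sum_prod_type, Fintype.sum_eq_single y]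
  · apply Finset.sum_congr rfl
    intro a _
    rw [mul_elemIns_apply, if_pos rfl]
  · intro u hu
    apply Finset.sum_eq_zero
    intro a _
    rw [mul_elemIns_apply, if_neg hu]

/-! ## §3 Translation-invariant propagators on a finite additive group (matrix-valued and colour-diagonal kernels) -/

section Conv

variable [AddCommGroup Λ]

/-- The translation-invariant kernel with MATRIX-VALUED (internal-index) entries `mconvKernel g (u,a) (v,b) = g (v − u) a b`
— the general shape of a U = 1 propagator on the unit torus `Λ` when `C` collects everything inside a block (fine
positions, directions, colours): invariance under unit-lattice translations only. [folklore] -/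
def mconvKernel (g : Λ → Matrix C C ℝ) : Matrix (Λ × C) (Λ × C) ℝ :=
  Matrix.of fun i j => g (j.1 - i.1) i.2 j.2

omit [Fintype Λ] [DecidableEq Λ] [Fintype C] [DecidableEq C] in
/-- Entries of `mconvKernel`. [folklore] -/
@[simp] theorem mconvKernel_apply (g : Λ → Matrix C C ℝ) (u v : Λ) (a b : C) :
    mconvKernel g (u, a) (v, b) = g (v - u) a b := rfl

omit [Fintype Λ] [DecidableEq Λ] [Fintype C] [DecidableEq C] in
/-- The blocks of `mconvKernel g` are the values of `g`: `block (mconvKernel g) u v = g (v − u)`. [folklore] -/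
theorem block_mconvKernel (g : Λ → Matrix C C ℝ) (u v : Λ) : block (mconvKernel g) u v = g (v - u) := by
  ext a b; rfl

omit [DecidableEq C] in
/-- **THE BUBBLE IS ONE PRODUCT OF TWO (MATRIX-VALUED) LEGS**:
`trace (G · E_{x,y,m} · (G′ · E_{x′,y′,m′})) = trace (g (x − y′) · m · (g′ (x′ − y) · m′))` for `G = mconvKernel g`,
`G′ = mconvKernel g′`. [folklore] -/
theorem bubble_elem_m (g g' : Λ → Matrix C C ℝ) (x y x' y' : Λ) (m m' : Matrix C C ℝ) :
    Matrix.trace (mconvKernel g * elemIns x y m * (mconvKernel g' * elemIns x' y' m')) =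
      Matrix.trace (g (x - y') * m * (g' (x' - y) * m')) := by
  rw [trace_mul_elemIns_mul, block_mconvKernel, block_mconvKernel]

omit [DecidableEq C] in
/-- **THE CONTACT TERM IS ONE LEG AT A FIXED OFFSET**: `trace (mconvKernel g · E_{x,y,m}) = trace (g (x − y) · m)`.
[folklore] -/
theorem contact_elem_m (g : Λ → Matrix C C ℝ) (x y : Λ) (m : Matrix C C ℝ) :
    Matrix.trace (mconvKernel g * elemIns x y m) = Matrix.trace (g (x - y) * m) := by
  rw [trace_mul_elemIns, block_mconvKernel]

omit [Fintype Λ] [DecidableEq Λ] [AddCommGroup Λ] [DecidableEq C] in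
/-- The colour trace of a product of two legs and two vertex matrices, written out as a finite sum of products of
SCALAR leg entries with vertex coefficients (the literal `Σ_i c_i·P_i·Q_i` shape, index `i = (a,b,c,d)`):
`trace (A · m · (B · m′)) = Σ_{a,c,d,b} A a b · m b c · (B c d · m′ d a)`. [folklore] -/
theorem trace_mul₄_eq_sum (A m B m' : Matrix C C ℝ) :
    Matrix.trace (A * m * (B * m')) = ∑ a, ∑ c, ∑ d, ∑ b, A a b * m b c * (B c d * m' d a) := by
  simp only [Matrix.trace, Matrix.diag, Matrix.mul_apply, Finset.sum_mul, Finset.mul_sum]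

/-- The translation-invariant COLOUR-DIAGONAL kernel `convKernel g (u,a) (v,b) = δ_{ab} · g (v − u)` (scalar propagator
times the identity in the internal indices, e.g. Feynman-type gauge and U = 1 colour structure). [folklore] -/
def convKernel (g : Λ → ℝ) : Matrix (Λ × C) (Λ × C) ℝ :=
  Matrix.of fun i j => if i.2 = j.2 then g (j.1 - i.1) else 0

omit [Fintype Λ] [DecidableEq Λ] [Fintype C] in
/-- Entries of `convKernel`. [folklore] -/
@[simp] theorem convKernel_apply (g : Λ → ℝ) (u v : Λ) (a b : C) :
    convKernel g (u, a) (v, b) = if a = b then g (v - u) else 0 := rfl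

omit [Fintype Λ] [DecidableEq Λ] [Fintype C] in
/-- `convKernel g` is `mconvKernel` of the scalar kernel `w ↦ g w • 1`. [folklore] -/
theorem convKernel_eq_mconvKernel (g : Λ → ℝ) :
    convKernel (C := C) g = mconvKernel fun w => g w • (1 : Matrix C C ℝ) := by
  ext ⟨u, a⟩ ⟨v, b⟩
  simp [Matrix.one_apply, Matrix.smul_apply]

omit [Fintype Λ] [DecidableEq Λ] [Fintype C] in
/-- The colour blocks of `convKernel g` are scalar: `block (convKernel g) u v = g (v − u) • 1`. [folklore] -/
theorem block_convKernel (g : Λ → ℝ) (u v : Λ) : block (convKernel (C := C) g) u v = g (v - u) • (1 : Matrix C C ℝ) := by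
  ext a b
  simp [Matrix.one_apply, Matrix.smul_apply]

/-- **SCALAR CASE**: for colour-diagonal `G = convKernel g`, `G′ = convKernel g′`:
`trace (G · E_{x,y,m} · (G′ · E_{x′,y′,m′})) = g (x − y′) · g′ (x′ − y) · trace (m · m′)`. [folklore] -/
theorem bubble_elem (g g' : Λ → ℝ) (x y x' y' : Λ) (m m' : Matrix C C ℝ) :
    Matrix.trace (convKernel g * elemIns x y m * (convKernel g' * elemIns x' y' m')) =
      g (x - y') * g' (x' - y) * Matrix.trace (m * m') := by
  rw [trace_mul_elemIns_mul, block_convKernel, block_convKernel]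
  simp only [Matrix.smul_mul, Matrix.mul_smul, Matrix.one_mul, Matrix.trace_smul, smul_eq_mul]
  ring

/-- **SCALAR CASE, CONTACT**: `trace (convKernel g · E_{x,y,m}) = g (x − y) · trace m`. [folklore] -/
theorem contact_elem (g : Λ → ℝ) (x y : Λ) (m : Matrix C C ℝ) :
    Matrix.trace (convKernel g * elemIns x y m) = g (x - y) * Matrix.trace m := by
  rw [trace_mul_elemIns, block_convKernel, Matrix.smul_mul, Matrix.one_mul, Matrix.trace_smul, smul_eq_mul]

end Conv

/-! ## §4 Stencil vertices and the table theorem -/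

section Stencil

variable [AddCommGroup Λ] {σ : Type*}

/-- A STENCIL VERTEX at background site `z`: finitely many elementary insertions at bounded offsets,
`stencilIns z S α β m = Σ_{s∈S} E_{z + α s, z + β s, m s}`. [folklore] -/
def stencilIns (z : Λ) (S : Finset σ) (α β : σ → Λ) (m : σ → Matrix C C ℝ) : Matrix (Λ × C) (Λ × C) ℝ :=
  ∑ s ∈ S, elemIns (z + α s) (z + β s) (m s)

omit [DecidableEq C] in
/-- BILINEARITY: the bubble of two stencil vertices is the double sum of elementary bubbles. [folklore] -/
theorem trace_bubble_stencil (K K' : Matrix (Λ × C) (Λ × C) ℝ) (z z' : Λ) (S S' : Finset σ) (α β α' β' : σ → Λ)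
    (m m' : σ → Matrix C C ℝ) :
    Matrix.trace (K * stencilIns z S α β m * (K' * stencilIns z' S' α' β' m')) =
      ∑ s ∈ S, ∑ t ∈ S', Matrix.trace (K * elemIns (z + α s) (z + β s) (m s) *
        (K' * elemIns (z' + α' t) (z' + β' t) (m' t))) := by
  simp only [stencilIns, Matrix.mul_sum, Matrix.sum_mul, Matrix.trace_sum]
  exact Finset.sum_comm

omit [DecidableEq C] in
/-- LINEARITY: the contact term of a stencil vertex is the sum of elementary contact terms. [folklore] -/
theorem trace_contact_stencil (K : Matrix (Λ × C) (Λ × C) ℝ) (z : Λ) (S : Finset σ) (α β : σ → Λ)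
    (m : σ → Matrix C C ℝ) :
    Matrix.trace (K * stencilIns z S α β m) = ∑ s ∈ S, Matrix.trace (K * elemIns (z + α s) (z + β s) (m s)) := by
  simp only [stencilIns, Matrix.mul_sum, Matrix.trace_sum]

omit [DecidableEq C] in
/-- **THE TABLE THEOREM, MATRIX-VALUED LEGS** (bubble of two stencil vertices at background sites `z` and `z + w`
through translation-invariant propagators with internal-index structure): a finite sum over the pairs of stencil points
of colour traces `trace (g (α s − β′ t − w) · m s · (g′ (w + α′ t − β s) · m′ t))`, each of which `trace_mul₄_eq_sum`
writes as a finite table of products of two SCALAR leg entries; nothing depends on `z`. [folklore] -/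
theorem bubble_stencil_eq_table_m (g g' : Λ → Matrix C C ℝ) (z w : Λ) (S S' : Finset σ) (α β α' β' : σ → Λ)
    (m m' : σ → Matrix C C ℝ) :
    Matrix.trace (mconvKernel g * stencilIns z S α β m * (mconvKernel g' * stencilIns (z + w) S' α' β' m')) =
      ∑ p ∈ S ×ˢ S', Matrix.trace (g (α p.1 - β' p.2 - w) * m p.1 * (g' (w + α' p.2 - β p.1) * m' p.2)) := by
  rw [trace_bubble_stencil, Finset.sum_product]
  apply Finset.sum_congr rfl
  intro s _
  apply Finset.sum_congr rfl
  intro t _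
  rw [bubble_elem_m]
  have h1 : z + α s - (z + w + β' t) = α s - β' t - w := by abel
  have h2 : z + w + α' t - (z + β s) = w + α' t - β s := by abel
  rw [h1, h2]

omit [DecidableEq C] in
/-- **THE CONTACT TERM OF A STENCIL VERTEX, MATRIX-VALUED LEGS**: `trace (mconvKernel g · V) = Σ_s trace (g (α s − β s) · m s)`
— values of `g` at the BOUNDED offsets of the stencil only. [folklore] -/
theorem contact_stencil_m (g : Λ → Matrix C C ℝ) (z : Λ) (S : Finset σ) (α β : σ → Λ) (m : σ → Matrix C C ℝ) :
    Matrix.trace (mconvKernel g * stencilIns z S α β m) = ∑ s ∈ S, Matrix.trace (g (α s - β s) * m s) := by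
  rw [trace_contact_stencil]
  apply Finset.sum_congr rfl
  intro s _
  rw [contact_elem_m]
  have h : z + α s - (z + β s) = α s - β s := by abel
  rw [h]

/-- **THE TABLE THEOREM** (bubble of two stencil vertices at background sites `z` and `z + w` through translation-invariant
colour-diagonal propagators): a finite table `Σ_{(s,t)} c_{s,t} · P_{s,t}(w) · Q_{s,t}(w)` whose legs are translates (one
reflected) of the propagator kernels and whose coefficients `c_{s,t} = trace (m s · m′ t)` do not depend on `w`, on the
volume or on `g`. [folklore] -/
theorem bubble_stencil_eq_table (g g' : Λ → ℝ) (z w : Λ) (S S' : Finset σ) (α β α' β' : σ → Λ)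
    (m m' : σ → Matrix C C ℝ) :
    Matrix.trace (convKernel g * stencilIns z S α β m * (convKernel g' * stencilIns (z + w) S' α' β' m')) =
      ∑ p ∈ S ×ˢ S', Matrix.trace (m p.1 * m' p.2) * (g (α p.1 - β' p.2 - w) * g' (w + α' p.2 - β p.1)) := by
  rw [trace_bubble_stencil, Finset.sum_product]
  apply Finset.sum_congr rfl
  intro s _
  apply Finset.sum_congr rfl
  intro t _
  rw [bubble_elem]
  have h1 : z + α s - (z + w + β' t) = α s - β' t - w := by abel
  have h2 : z + w + α' t - (z + β s) = w + α' t - β s := by abel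
  rw [h1, h2]
  ring

/-- The table does not see the base point: the bubble between the vertices at `z` and `z + w` depends on `w` only.
[folklore] -/
theorem bubble_stencil_translate (g g' : Λ → ℝ) (z₁ z₂ w : Λ) (S S' : Finset σ) (α β α' β' : σ → Λ)
    (m m' : σ → Matrix C C ℝ) :
    Matrix.trace (convKernel g * stencilIns z₁ S α β m * (convKernel g' * stencilIns (z₁ + w) S' α' β' m')) =
      Matrix.trace (convKernel g * stencilIns z₂ S α β m * (convKernel g' * stencilIns (z₂ + w) S' α' β' m')) := by
  rw [bubble_stencil_eq_table, bubble_stencil_eq_table]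

/-- **THE CONTACT TERM OF A STENCIL VERTEX**: `trace (convKernel g · V) = Σ_s g (α s − β s) · trace (m s)` — values of `g` at
the BOUNDED offsets of the stencil only (no long legs). [folklore] -/
theorem contact_stencil (g : Λ → ℝ) (z : Λ) (S : Finset σ) (α β : σ → Λ) (m : σ → Matrix C C ℝ) :
    Matrix.trace (convKernel g * stencilIns z S α β m) = ∑ s ∈ S, g (α s - β s) * Matrix.trace (m s) := by
  rw [trace_contact_stencil]
  apply Finset.sum_congr rfl
  intro s _
  rw [contact_elem]
  have h : z + α s - (z + β s) = α s - β s := by abel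
  rw [h]

end Stencil

/-! ## §5 The difference mechanism (vanishing coefficient sums turn translated legs into difference legs) -/

section Differences

variable {σ : Type*}

/-- If `Σ_s c_s = 0` then `Σ_s c_s · F s = Σ_s c_s · (F s − F₀)` for any reference value `F₀`. [folklore] -/
theorem sum_mul_eq_sum_mul_sub (S : Finset σ) (c F : σ → ℝ) (F₀ : ℝ) (h : ∑ s ∈ S, c s = 0) :
    ∑ s ∈ S, c s * F s = ∑ s ∈ S, c s * (F s - F₀) := by
  simp only [mul_sub, Finset.sum_sub_distrib, ← Finset.sum_mul, h, zero_mul, sub_zero]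

/-- Two-leg version: if for each fixed second leg the coefficient sum over the first stencil index vanishes,
`∀ t, Σ_s c (s,t) = 0`, then the first legs may be replaced by their differences against any `t`-dependent reference:
`Σ_{s,t} c(s,t)·P(s,t)·Q(t) = Σ_{s,t} c(s,t)·(P(s,t) − P₀(t))·Q(t)`. [folklore] -/
theorem table_relabel_differences (S T : Finset σ) (c P : σ × σ → ℝ) (P₀ Q : σ → ℝ)
    (h : ∀ t ∈ T, ∑ s ∈ S, c (s, t) = 0) :
    ∑ p ∈ S ×ˢ T, c p * (P p * Q p.2) = ∑ p ∈ S ×ˢ T, c p * ((P p - P₀ p.2) * Q p.2) := by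
  rw [Finset.sum_product_right, Finset.sum_product_right]
  apply Finset.sum_congr rfl
  intro t ht
  have h0 : ∑ s ∈ S, c (s, t) * (P₀ t * Q t) = 0 := by
    rw [← Finset.sum_mul, h t ht, zero_mul]
  have : ∀ s ∈ S, c (s, t) * ((P (s, t) - P₀ t) * Q t) = c (s, t) * (P (s, t) * Q t) - c (s, t) * (P₀ t * Q t) := by
    intro s _; ring
  rw [Finset.sum_congr rfl this, Finset.sum_sub_distrib, h0, sub_zero]

end Differences

/-! ## §6 The (M)-output shape: polarization = contact − bubble, as a table in the offset -/

section Polarization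

variable [AddCommGroup Λ] {σ : Type*}

/-- The (M)-OUTPUT SHAPE (right-hand side of `Beta.LogDetHessian.fderiv_fderiv_log_det` for a family `K(B)` with
`∂_zK(0) = V z`, `∂_z∂_{z′}K(0) = V₂ z z′` and `G = K(0)⁻¹`): the polarization
`polarization G V V₂ z z′ = trace (G · V₂ z z′) − trace (G · V z · (G · V z′))` = `∂_z∂_{z′} log det K (0)`.
(The one-loop term of the effective action is `−½ log det K`, so `Π = −½ · polarization` in the log-det route; signs as
in AN2.md §10.0.)  A definition; the identification with the derivative is the tree theorem just named, not re-proved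
here. [folklore] -/
def polarization (G : Matrix (Λ × C) (Λ × C) ℝ) (V : Λ → Matrix (Λ × C) (Λ × C) ℝ)
    (V₂ : Λ → Λ → Matrix (Λ × C) (Λ × C) ℝ) (z z' : Λ) : ℝ :=
  Matrix.trace (G * V₂ z z') - Matrix.trace (G * V z * (G * V z'))

/-- **POLARIZATION AS A TABLE IN THE OFFSET.**  If the first-order vertices are the SAME stencil translated to each
background site (`V z = stencilIns z S α β m`), the second-order vertex at `(z, z + w)` is a stencil at `z` with
`w`-dependent data (`V₂ z (z + w) = stencilIns z (S₂ w) (α₂ w) (β₂ w) (m₂ w)`), and `G = convKernel g` is translation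
invariant and colour diagonal, then
`polarization G V V₂ z (z + w) = Σ_{s ∈ S₂ w} g(α₂ w s − β₂ w s)·trace(m₂ w s) − Σ_{(s,t) ∈ S × S} trace(m s · m t)·g(α s − β t − w)·g(w + α t − β s)`
— independent of `z`, a contact table with `g` at bounded offsets minus a leg table. [folklore] -/
theorem polarization_eq_table (g : Λ → ℝ) (S : Finset σ) (α β : σ → Λ) (m : σ → Matrix C C ℝ)
    (S₂ : Λ → Finset σ) (α₂ β₂ : Λ → σ → Λ) (m₂ : Λ → σ → Matrix C C ℝ)
    (V : Λ → Matrix (Λ × C) (Λ × C) ℝ) (V₂ : Λ → Λ → Matrix (Λ × C) (Λ × C) ℝ)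
    (hV : ∀ z, V z = stencilIns z S α β m) (hV₂ : ∀ z w, V₂ z (z + w) = stencilIns z (S₂ w) (α₂ w) (β₂ w) (m₂ w))
    (z w : Λ) :
    polarization (convKernel g) V V₂ z (z + w) =
      (∑ s ∈ S₂ w, g (α₂ w s - β₂ w s) * Matrix.trace (m₂ w s)) -
        ∑ p ∈ S ×ˢ S, Matrix.trace (m p.1 * m p.2) * (g (α p.1 - β p.2 - w) * g (w + α p.2 - β p.1)) := by
  rw [polarization, hV₂, hV, hV, contact_stencil, bubble_stencil_eq_table]

/-- Consequently the polarization is a function of the offset alone (translation invariance of the one-loop kernel on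
the torus). [folklore] -/
theorem polarization_translate (g : Λ → ℝ) (S : Finset σ) (α β : σ → Λ) (m : σ → Matrix C C ℝ)
    (S₂ : Λ → Finset σ) (α₂ β₂ : Λ → σ → Λ) (m₂ : Λ → σ → Matrix C C ℝ)
    (V : Λ → Matrix (Λ × C) (Λ × C) ℝ) (V₂ : Λ → Λ → Matrix (Λ × C) (Λ × C) ℝ)
    (hV : ∀ z, V z = stencilIns z S α β m) (hV₂ : ∀ z w, V₂ z (z + w) = stencilIns z (S₂ w) (α₂ w) (β₂ w) (m₂ w))
    (z₁ z₂ w : Λ) :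
    polarization (convKernel g) V V₂ z₁ (z₁ + w) = polarization (convKernel g) V V₂ z₂ (z₂ + w) := by
  rw [polarization_eq_table g S α β m S₂ α₂ β₂ m₂ V V₂ hV hV₂, polarization_eq_table g S α β m S₂ α₂ β₂ m₂ V V₂ hV hV₂]

/-- **FINITE SUPPORT OF THE CONTACT TABLE.**  If the second-order vertex vanishes for offsets outside a finite set `W₂`
(locality of the operator: `V₂ z (z + w) = 0` for `w ∉ W₂`), then outside `W₂` the polarization is MINUS the leg table
alone. [folklore] -/
theorem polarization_eq_neg_bubble_of_not_mem (g : Λ → ℝ) (S : Finset σ) (α β : σ → Λ) (m : σ → Matrix C C ℝ)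
    (V : Λ → Matrix (Λ × C) (Λ × C) ℝ) (V₂ : Λ → Λ → Matrix (Λ × C) (Λ × C) ℝ) (W₂ : Finset Λ)
    (hV : ∀ z, V z = stencilIns z S α β m) (hloc : ∀ z w, w ∉ W₂ → V₂ z (z + w) = 0) (z w : Λ) (hw : w ∉ W₂) :
    polarization (convKernel g) V V₂ z (z + w) =
      -∑ p ∈ S ×ˢ S, Matrix.trace (m p.1 * m p.2) * (g (α p.1 - β p.2 - w) * g (w + α p.2 - β p.1)) := by
  rw [polarization, hloc z w hw, hV, hV, bubble_stencil_eq_table, Matrix.mul_zero, Matrix.trace_zero, zero_sub]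

end Polarization

/-! ## Examples -/

section Examples

/-- On the one-site lattice `Unit` with one colour, the bubble of two unit insertions through the kernel `g ≡ 2` is
`2 · 2 · 1 = 4`. [folklore] -/
example : Matrix.trace (convKernel (Λ := Unit) (C := Unit) (fun _ => (2 : ℝ)) * elemIns () () 1 *
    (convKernel (fun _ => (2 : ℝ)) * elemIns () () 1)) = 4 := by
  rw [bubble_elem]
  simp
  norm_num

/-- The difference mechanism on two points with coefficients `1, −1`: `F a − F b = (F a − F₀) − (F b − F₀)`. [folklore] -/
example (F : Bool → ℝ) (F₀ : ℝ) :
    ∑ s ∈ ({true, false} : Finset Bool), (if s then (1 : ℝ) else -1) * F s =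
      ∑ s ∈ ({true, false} : Finset Bool), (if s then (1 : ℝ) else -1) * (F s - F₀) :=
  sum_mul_eq_sum_mul_sub _ _ _ _ (by simp)

end Examples

end Literature.MathematicalPhysics.QuantumFieldTheory.Balaban1983to89.Beta.BubbleTable
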